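import Literature.AlgebraicGeometry.Frobenioids.AutSubAmpleCexFrobenioid
import Literature.AlgebraicGeometry.Frobenioids.FiberProductsAutSubAmpleStatement
import Literature.AlgebraicGeometry.Frobenioids.CoAngular
import HarnessLib

/-!
# [FrdI] Prop. 1.6 (vi), clause «Aut^sub-ample», direction `C ⇒ C′`: the kernel counterexample

Mochizuki, *The geometry of Frobenioids I: the general theory*, Kyushu J. Math. **62** (2008)
293–400, §1, Proposition 1.6 (vi), kurims text p. 27 [cite: MochizukiFrdI2008, Prop. 1.6(vi) p.27]:

> "(vi) A object of `C′` is Aut-ample (respectively, Aut^sub-ample; End-ample) if it projects to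
> such an object of `C`."

OURS (abc-iut cell, finding F-w5d202-1; NOT a construction of the paper): a kernel witness that the
clause «Aut^sub-ample» (direction `C ⇒ C′`, `C′ := C ×_D D′`) is FALSE AS PRINTED under the standing
hypotheses of Prop. 1.6 (p. 27: `C → F_Φ` a Frobenioid over a connected, totally epimorphic `D`, `Φ`
divisorial; `D′ → D` a functor between connected, totally epimorphic categories mapping FSM-morphisms
to FSM-morphisms).  The clauses «Aut-ample»/«End-ample» are PROVED in the tree (abc-iut-found,
`PreFrobenioid.isAutAmple_fiberProduct_of_fst` / `isEndAmple_fiberProduct_of_fst`); «Aut^sub-ample»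
was left open there ("the evident lifting argument needs a sub-automorphism of the `C`-component with
PRESCRIBED projection to `D`", `FiberProductsMorphisms.lean`).  The four files of the witness:
`AutSubAmpleCexBase` (the base `D`, the sub-category `D′`), `AutSubAmpleCexMonoids` (the lexicographic
cones `L₂`, `L₃`), `AutSubAmpleCexFrobenioid` (the divisor monoid `Φ`, `B = 0_D`, the model Frobenioid
`C`, integer coordinates on `L₂^gp`), `AutSubAmpleFiberProductCounterexample` (the objects `A`, `X` and
the refutation).  Neutral record under the cell's typing; nothing here bears on [IUTchIII] Cor. 3.12.

THIS FILE, the witness proper: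
* `A := (P, α)` with `α = (−1, 0) ∈ L₂^gp` IS `Aut^sub`-ample in `C`: for every `j ≥ 0` the
  endomorphism `αⱼ := (1, gʲ, Div = (0, j))` of `A` over `gʲ` is a sub-automorphism — witness over
  `E₁`: the object `B₁ = (E₁, (−1, 0, 0))`, its automorphism `(1, bʲ₁, 0)` and the arrow
  `ψ₁ = (1, χ¹₀, (1, −1, 0)) : B₁ → A` (`isAutSubAmple_A`);
* `X := (A, P, id) ∈ C′ = C ×_D D′` is NOT `Aut^sub`-ample (`not_isAutSubAmple_X`): `g` is a
  sub-automorphism of `P` in `D′` (witness `(E₀, χ⁰₀, b₀)`), but a sub-automorphism of `X` over `g`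
  would need a `C′`-object over `E₀` whose `C`-component `(E₀, θ)` carries an automorphism over `b₀⁻¹`
  — which forces `y(θ) ≥ 0` in coordinates — together with an arrow `(E₀, θ) → A` of some degree `d`
  over some `χ⁰ₙ`, whose zero divisor would then have `y`-coordinate `−1 − d·y(θ) < 0`, i.e. would
  not lie in `L₂`;
* hence `not_prop16viAutSubAmpleIf : ¬ PreFrobenioid.Prop16viAutSubAmpleIf` (the printed clause as
  named in `FiberProductsAutSubAmpleStatement.lean`).
The positive content survives: if the lift of `Base` can be chosen ISOMETRIC (e.g. at `Aut`-ample
objects, or where sub-automorphisms are isometric as under the non-expanding hypotheses of the cell's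
RULING P12-NE), the clause holds by the pull-back / cartesian-lift argument (Def. 1.3 (i)(c),
Prop. 1.4 (iii)).
-/

noncomputable section

namespace Literature.AlgebraicGeometry.Frobenioids

open CategoryTheory Opposite Function

namespace AutSubAmpleCex

/-! ### The object `A = (P, (−1, 0))` is `Aut^sub`-ample -/

/-- `(1, 0) ∈ L₂`. [cite: MochizukiFrdI2008, Prop. 1.6(vi) p.27] -/
def e2 : L2 := ⟨1, 0, Or.inl one_pos⟩

/-- `α = (−1, 0) ∈ L₂^gp`. [cite: MochizukiFrdI2008, Prop. 1.6(vi) p.27] -/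
def α : Algebra.GrothendieckGroup L2 := (Algebra.GrothendieckGroup.of e2)⁻¹

/-- `Ev p q α = −p`. [cite: MochizukiFrdI2008, Prop. 1.6(vi) p.27] -/
@[simp] theorem Ev_α (p q : ℤ) : Ev p q α = (Multiplicative.ofAdd p)⁻¹ := by
  rw [α, map_inv, Ev_of]
  simp [e2]

/-- The object `A := (P, α)` of `C`. [cite: MochizukiFrdI2008, Prop. 1.6(vi) p.27] -/
def A : Cx := ⟨BObj.P, α⟩

/-- `(1, 0, 0) ∈ L₃`. [cite: MochizukiFrdI2008, Prop. 1.6(vi) p.27] -/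
def e3 : L3 := ⟨1, 0, 0, Or.inl one_pos⟩

/-- The witness object `B₁ := (E₁, (−1, 0, 0))` of `C`. [cite: MochizukiFrdI2008, Prop. 1.6(vi) p.27] -/
def B1 : Cx := ⟨BObj.E1, (Algebra.GrothendieckGroup.of e3)⁻¹⟩

/-- `(1, −1, 0) ∈ L₃`, the zero divisor of the witness arrow `B₁ → A`. [cite: MochizukiFrdI2008, Prop. 1.6(vi) p.27] -/
def z1 : L3 := ⟨1, -1, 0, Or.inl one_pos⟩

/-- `(0, j) ∈ L₂` for `j ≥ 0`, the zero divisor of the lift `αⱼ`. [cite: MochizukiFrdI2008, Prop. 1.6(vi) p.27] -/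
def dj (f : BObj.P ⟶ BObj.P) : L2 := ⟨0, f.val, Or.inr ⟨rfl, P_val_nonneg f⟩⟩

/-- In a Grothendieck group, `b · c = a` gives `a⁻¹ · b = c⁻¹`. [cite: MochizukiFrdI2008, §0 p.11] -/
theorem inv_of_mul_of {M : Type} [CommMonoid M] {a b c : M} (h : b * c = a) :
    (Algebra.GrothendieckGroup.of a)⁻¹ * Algebra.GrothendieckGroup.of b =
      (Algebra.GrothendieckGroup.of c)⁻¹ := by
  rw [inv_mul_eq_iff_eq_mul, ← h, map_mul, mul_inv_cancel_right]

/-- `(0, j) · σⱼ(1, 0) = (1, 0)` in `L₂`. [cite: MochizukiFrdI2008, Prop. 1.6(vi) p.27] -/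
theorem dj_mul_shear_e2 (f : BObj.P ⟶ BObj.P) : dj f * L2.shear f.val e2 = e2 :=
  L2.ext (by simp [dj, e2]) (by simp [dj, e2])

/-- The lift `αⱼ := (1, gʲ, (0, j), 0)` of `gʲ : P → P` to an endomorphism of `A`.
[cite: MochizukiFrdI2008, Prop. 1.6(vi) p.27] -/
noncomputable def liftAr (f : BObj.P ⟶ BObj.P) : A ⟶ A :=
  ModelFrobenioid.mkHom A A 1 f (dj f) 1 (by
    rw [PNat.one_coe, pow_one, divB_eq_one, mul_one]
    change α * _ = pullGp Phi f (Algebra.GrothendieckGroup.of e2)⁻¹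
    rw [map_inv, pullGp_of, α]
    exact inv_of_mul_of (dj_mul_shear_e2 f))

/-- `(1, −1, 0) · τ₀ r(1, 0) = (1, 0, 0)` in `L₃`. [cite: MochizukiFrdI2008, Prop. 1.6(vi) p.27] -/
theorem z1_mul : z1 * L3.shear 0 (L3.incl e2) = e3 :=
  L3.ext (by simp [e2, e3, z1]) (by simp [e2, e3, z1]) (by simp [e2, e3, z1])

/-- The witness arrow `ψ₁ := (1, χ¹₀, (1, −1, 0), 0) : B₁ → A`. [cite: MochizukiFrdI2008, Prop. 1.6(vi) p.27] -/
noncomputable def ψ1 : B1 ⟶ A :=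
  ModelFrobenioid.mkHom B1 A 1 (ar BObj.E1 BObj.P 0 trivial) z1 1 (by
    rw [PNat.one_coe, pow_one, divB_eq_one, mul_one]
    change (Algebra.GrothendieckGroup.of e3)⁻¹ * _ =
      pullGp Phi (ar BObj.E1 BObj.P 0 trivial) (Algebra.GrothendieckGroup.of e2)⁻¹
    rw [map_inv, pullGp_of]
    exact inv_of_mul_of z1_mul)

/-- `τₖ (1, 0, 0) = (1, 0, 0)`. [cite: MochizukiFrdI2008, Prop. 1.6(vi) p.27] -/
theorem shear_e3 (k : ℤ) : L3.shear k e3 = e3 := L3.ext rfl rfl (by simp [e3])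

/-- The automorphism `(1, bᵏ₁, 0, 0)` of `B₁` as an arrow. [cite: MochizukiFrdI2008, Prop. 1.6(vi) p.27] -/
noncomputable def βar (k : ℤ) : B1 ⟶ B1 :=
  ModelFrobenioid.mkHom B1 B1 1 (ar BObj.E1 BObj.E1 k trivial) 1 1 (by
    rw [PNat.one_coe, pow_one, divB_eq_one, mul_one, map_one, mul_one]
    change (Algebra.GrothendieckGroup.of e3)⁻¹ =
      pullGp Phi (ar BObj.E1 BObj.E1 k trivial) (Algebra.GrothendieckGroup.of e3)⁻¹
    rw [map_inv, pullGp_of]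
    exact congrArg (fun t : L3 => (Algebra.GrothendieckGroup.of t)⁻¹) (shear_e3 k).symm)

/-- `(1, bᵏ₁, 0, 0) ∘ (1, bˡ₁, 0, 0) = id` when `k + l = 0`. [cite: MochizukiFrdI2008, Prop. 1.6(vi) p.27] -/
theorem βar_comp (k l : ℤ) (h : k + l = 0) : βar k ≫ βar l = 𝟙 B1 := by
  have key : L3.shear k (1 : L3) * (1 : L3) ^ ((1 : ℕ+) : ℕ) = 1 := by
    rw [map_one, one_pow, mul_one]
  exact ModelFrobenioid.hom_ext rfl (hom_ext h) key rfl

/-- The automorphism `β₁ := (1, bʲ₁, 0, 0)` of `B₁`. [cite: MochizukiFrdI2008, Prop. 1.6(vi) p.27] -/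
noncomputable def β1 (j : ℤ) : B1 ≅ B1 where
  hom := βar j
  inv := βar (-j)
  hom_inv_id := βar_comp _ _ (add_neg_cancel j)
  inv_hom_id := βar_comp _ _ (neg_add_cancel j)

/-- The sub-automorphism equation `β₁ ≫ ψ₁ = ψ₁ ≫ αⱼ` (i.e. `ψ₁ ∘ β₁ = αⱼ ∘ ψ₁`).
[cite: MochizukiFrdI2008, Prop. 1.6(vi) p.27] -/
theorem β1_ψ1 (f : BObj.P ⟶ BObj.P) : (β1 f.val).hom ≫ ψ1 = ψ1 ≫ liftAr f := by
  have key : L3.shear f.val z1 * (1 : L3) ^ ((1 : ℕ+) : ℕ) =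
      L3.shear 0 (L3.incl (dj f)) * z1 ^ ((1 : ℕ+) : ℕ) :=
    L3.ext (by simp [z1, dj]) (by simp [z1, dj]) (by simp [z1, dj])
  exact ModelFrobenioid.hom_ext rfl (hom_ext (show f.val + 0 = 0 + f.val by omega)) key rfl

/-- Every lift `αⱼ` is a sub-automorphism of `A`. [cite: MochizukiFrdI2008, Prop. 1.6(vi) p.27] -/
theorem liftAr_mem_autSub (f : BObj.P ⟶ BObj.P) : liftAr f ∈ autSub A :=
  ⟨B1, ψ1, β1 f.val, β1_ψ1 f⟩

/-- **`A = (P, (−1, 0))` is `Aut^sub`-ample**: every `gʲ` lifts to the sub-automorphism `αⱼ`.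
[cite: MochizukiFrdI2008, Prop. 1.6(vi) p.27] -/
theorem isAutSubAmple_A : PreFrobenioid.IsAutSubAmple Fx A :=
  fun f _ => ⟨liftAr f, liftAr_mem_autSub f, rfl⟩

/-! ### The object `X = (A, P, id)` of `C ×_D D′` is not `Aut^sub`-ample -/

/-- The object `X := (A, P, id)` of `C′ = C ×_D D′`. [cite: MochizukiFrdI2008, Prop. 1.6(vi) p.27] -/
def X : PreFrobenioid.FiberProduct Fx G := ⟨A, ⟨BObj.P⟩, Iso.refl BObj.P⟩

/-- `g : P → P` as an arrow of `D′`. [cite: MochizukiFrdI2008, Prop. 1.6(vi) p.27] -/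
def g1 : (⟨BObj.P⟩ : D') ⟶ ⟨BObj.P⟩ := ⟨ar BObj.P BObj.P 1 Int.one_nonneg, trivial⟩

/-- The automorphism `b₀` of `E₀` in `D′`. [cite: MochizukiFrdI2008, Prop. 1.6(vi) p.27] -/
def b0 : (⟨BObj.E0⟩ : D') ≅ ⟨BObj.E0⟩ where
  hom := ⟨ar BObj.E0 BObj.E0 1 trivial, trivial⟩
  inv := ⟨ar BObj.E0 BObj.E0 (-1) trivial, trivial⟩
  hom_inv_id := WideSubcategory.hom_ext _ (hom_ext rfl)
  inv_hom_id := WideSubcategory.hom_ext _ (hom_ext rfl)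

/-- `g` is a sub-automorphism of `P` in `D′` (witness `(E₀, χ⁰₀, b₀)`). [cite: MochizukiFrdI2008, Prop. 1.6(vi) p.27] -/
theorem g1_mem_autSub : g1 ∈ autSub (⟨BObj.P⟩ : D') :=
  ⟨⟨BObj.E0⟩, ⟨ar BObj.E0 BObj.P 0 trivial, trivial⟩, b0, WideSubcategory.hom_ext _ (hom_ext rfl)⟩

/-- From the relation of an endomorphism of `(E₀, θ)` in `C`, integer equations: apply `Ev p q` and
`toAdd`. [cite: MochizukiFrdI2008, Thm. 5.2(i) p.100] -/
theorem rel_E0E0 (p q : ℤ) {θ : Algebra.GrothendieckGroup L2}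
    (β : (⟨BObj.E0, θ⟩ : Cx) ⟶ ⟨BObj.E0, θ⟩) :
    (ModelFrobenioid.degFr β : ℤ) * (Ev p q θ).toAdd +
        (p * (ModelFrobenioid.div β).y + q * (ModelFrobenioid.div β).x) =
      (Ev (p - q * (ModelFrobenioid.baseMap β).val) q θ).toAdd := by
  have h0 := ModelFrobenioid.rel β
  rw [divB_eq_one, mul_one] at h0
  have h : (Ev p q (θ ^ (ModelFrobenioid.degFr β : ℕ) *
      Algebra.GrothendieckGroup.of (M := L2) (ModelFrobenioid.div β))).toAdd =
      (Ev p q (pullGp Phi (ModelFrobenioid.baseMap β) θ)).toAdd :=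
    congrArg (fun z => (Ev p q z).toAdd) h0
  rw [map_mul, map_pow, toAdd_mul, toAdd_pow, nsmul_eq_mul, Ev_of, toAdd_ofAdd, Ev_pullGp_E0E0] at h
  exact h

/-- Integer equations from the relation of an arrow `(E₀, θ) → A`. [cite: MochizukiFrdI2008, Thm. 5.2(i) p.100] -/
theorem rel_E0P (p q : ℤ) {θ : Algebra.GrothendieckGroup L2} (ψ : (⟨BObj.E0, θ⟩ : Cx) ⟶ A) :
    (ModelFrobenioid.degFr ψ : ℤ) * (Ev p q θ).toAdd +
        (p * (ModelFrobenioid.div ψ).y + q * (ModelFrobenioid.div ψ).x) =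
      -(p - q * (ModelFrobenioid.baseMap ψ).val) := by
  have h0 := ModelFrobenioid.rel ψ
  rw [divB_eq_one, mul_one] at h0
  have h : (Ev p q (θ ^ (ModelFrobenioid.degFr ψ : ℕ) *
      Algebra.GrothendieckGroup.of (M := L2) (ModelFrobenioid.div ψ))).toAdd =
      (Ev p q (pullGp Phi (X := BObj.E0) (Y := BObj.P) (ModelFrobenioid.baseMap ψ) α)).toAdd :=
    congrArg (fun z => (Ev p q z).toAdd) h0
  rw [map_mul, map_pow, toAdd_mul, toAdd_pow, nsmul_eq_mul, Ev_of, toAdd_ofAdd, Ev_pullGp_E0P, Ev_α,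
    toAdd_inv, toAdd_ofAdd] at h
  exact h

/-- **`X = (A, P, id)` is NOT `Aut^sub`-ample** in `C ×_D D′`: no sub-automorphism of `X` lies over `g`.
[cite: MochizukiFrdI2008, Prop. 1.6(vi) p.27] -/
theorem not_isAutSubAmple_X :
    ¬ PreFrobenioid.IsAutSubAmple (PreFrobenioid.fiberProductFunctor Fx G) X := by
  intro h
  obtain ⟨αt, ⟨Y, ψt, βt, heq⟩, hbase⟩ := h g1 g1_mem_autSub
  change αt.snd = g1 at hbase
  -- the `D′`-components: `βt.hom.snd` has label `1`, `βt.inv.snd` has label `-1`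
  have h2 := congrArg (fun k : Y ⟶ X => k.snd.hom.val) heq
  simp only [CFP.comp_snd, WideSubcategory.comp_def, comp_val, hbase] at h2
  have hg1 : g1.hom.val = 1 := rfl
  rw [hg1] at h2
  have h3 := congrArg (fun k : Y ⟶ Y => k.snd.hom.val) βt.hom_inv_id
  simp only [CFP.comp_snd, CFP.id_snd, WideSubcategory.comp_def, WideSubcategory.id_def, comp_val,
    id_val] at h3
  obtain ⟨⟨Yb, θ⟩, ⟨Ys⟩, Yi⟩ := Y
  cases Ys
  · -- `Y.snd = P`: an automorphism of `P` with label `-1` is impossible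
    have := P_val_nonneg βt.inv.snd.hom
    omega
  · -- `Y.snd = E₀`: the `C`-component lies over `E₀`
    cases Yb
    · exact no_P_E0 Yi.hom
    · -- the main case: `θ ∈ L₂^gp`, `βt.inv.fst` an automorphism of `(E₀, θ)` over `b₀⁻¹`
      have h4 : (ModelFrobenioid.baseMap βt.inv.fst).val + Yi.hom.val =
          Yi.hom.val + βt.inv.snd.hom.val :=
        congrArg BHom.val βt.inv.w
      have hb : (ModelFrobenioid.baseMap βt.inv.fst).val = -1 := by omega
      haveI : IsIso βt.inv.fst := CFP.isIso_fst βt.inv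
      have hdeg : ModelFrobenioid.degFr βt.inv.fst = 1 :=
        PreFrobenioid.isLinear_of_isIso Fx βt.inv.fst
      have e10 := rel_E0E0 1 0 βt.inv.fst
      have e01 := rel_E0E0 0 1 βt.inv.fst
      rw [hdeg, hb] at e10 e01
      norm_num at e10 e01
      -- `e10 : (div β).y = 0`, `e01 : (Ev 0 1 θ).toAdd + (div β).x = (Ev 1 1 θ).toAdd`
      have hx0 := L2.x_nonneg_of_y_eq_zero _ e10
      -- the arrow `ψ : (E₀, θ) → A`
      have f11 := rel_E0P 1 1 ψt.fst
      have f01 := rel_E0P 0 1 ψt.fst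
      norm_num at f11 f01
      have hdy := (ModelFrobenioid.div ψt.fst).y_nonneg
      have hd : (0 : ℤ) < (ModelFrobenioid.degFr ψt.fst : ℤ) := by
        exact_mod_cast (ModelFrobenioid.degFr ψt.fst).pos
      have key : (0 : ℤ) ≤ (ModelFrobenioid.degFr ψt.fst : ℤ) * ((Ev 1 1 θ).toAdd - (Ev 0 1 θ).toAdd) :=
        mul_nonneg hd.le (by omega)
      nlinarith
    · exact no_E1_E0 Yi.hom
  · -- `Y.snd = E₁`: `βt.hom.snd` must be the identity of `E₁` in `D′`
    have := βt.hom.snd.property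
    change βt.hom.snd.hom.val = 0 at this
    omega

/-- **The witness**: an object of `C ×_D D′` that projects to an `Aut^sub`-ample object of `C` but is
not `Aut^sub`-ample. [cite: MochizukiFrdI2008, Prop. 1.6(vi) p.27] -/
theorem exists_fst_isAutSubAmple_not_isAutSubAmple :
    ∃ X : PreFrobenioid.FiberProduct Fx G, PreFrobenioid.IsAutSubAmple Fx X.fst ∧
      ¬ PreFrobenioid.IsAutSubAmple (PreFrobenioid.fiberProductFunctor Fx G) X :=
  ⟨X, isAutSubAmple_A, not_isAutSubAmple_X⟩

/-- **Prop. 1.6 (vi), «Aut^sub-ample», direction `C ⇒ C′`, is false as printed** (kernel witness: the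
model Frobenioid over the three-object base `D` of `AutSubAmpleCexBase`, base-changed along the wide
subcategory `D′ ⊂ D` that forgets the automorphisms of `E₁`). [cite: MochizukiFrdI2008, Prop. 1.6(vi) p.27] -/
theorem not_prop16viAutSubAmpleIf : ¬ PreFrobenioid.Prop16viAutSubAmpleIf := by
  intro h
  exact not_isAutSubAmple_X (h Fx G isFrobenioid isGraphConnected_D' isTotallyEpimorphic_D'
    (fun f hf => map_isFSM f hf) X isAutSubAmple_A)

end AutSubAmpleCex

end Literature.AlgebraicGeometry.Frobenioids
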